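import Summits.RiemannHypothesis.RiemannHypothesis.Theorems.TiltedLandingLaw421R2Ready

/-! # TiltedLandingLaw421R2TrkD
W-08 round-2 TRACKED-LINEAGE TOKENS (ns `RhW08.Round1`, C1 g22 §R1/§R1i subset): `TrkStepD`/`StTrkD` (down-first successor), `PTrkD`, `EmptyTrkD`; round-1 texts kept only where round-2 bridges cite them.
SUPPORT module for crux `TiltedLandingLaw421` (stmt-RiemannHypothesis-24774), `--supports` only: proves no stub, no crux; fully proved (no `sorry`).
ROUND-2 DRY CUT by tenure rh-tenure-earlyapp-1 g5 (NOT keyed, NOT of record) from the single rc-0 base `R1K8R2KCheck-W08-C1-rh-idea-5-g23.lean` fef2bb59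
(C1 RIDER-42 BASE-A): decl blocks byte-verbatim, base order, dependency closure of the round-2 nodes; K = kernel-checked lemmas about MODEL sockets (combs), not ζ/Ξ. RH is not proved. -/

-- ----- from C1 g22 TreeR1 body §R1–§R1i (+§R1h) -----
namespace RhW08.Round1

open Complex
open RhIdea6.G17.W07C7 RhIdea6.G17.W07C7.Rev6 RhIdea6.G18.W07C8.Law421BirthS RhIdea6.G19.W07C11.Seam
open RhIdea6.G20.W07C12.Frac RhIdea6.G20.W07C12.StColP RhW07.C12.FieldSplit RhIdea6.G21.W07C13.TentMax
open RhW07.C14.TwoSided RhW07.C14.Classes RhW07.C14.Lineage RhW07.C14.Booking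
open RhW07.C13.Heredity RhIdea6.G22.W07C15pre.Injection RhW07.E3.Cell
open RhW07.E3.Lit

section Generic

/-- disjunction of two state predicates. -/
def POr (P Q : StatePred) : StatePred := fun η f x₀ s hmax R Hs B j u =>
  P η f x₀ s hmax R Hs B j u ∨ Q η f x₀ s hmax R Hs B j u

/-- (K) α-low socket: a disjunctive seal whose second disjunct IS the successor slot transfers for free. -/
theorem isolatedPairDropLowG_pOr_succOf {μ : ℝ} {P St Ready : StatePred}
    (h : IsolatedPairDropLowG μ P St Ready) : IsolatedPairDropLowG μ (POr P (SuccOf μ St)) St Ready := by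
  intro η f x₀ s hmax R Hs B hE j v hlow hnr hp
  rcases hp with hp | hp
  · exact h η f x₀ s hmax R Hs B hE j v hlow hnr hp
  · exact hp

/-- (β) generalised EMPTY class over an arbitrary tracked-state predicate (the record's `EmptyClass ρ` is the `StCol'` instance, `rfl`). -/
def EmptyClassG (St : StatePred) (ρ : ℝ) : LevelClass := fun η f x₀ s hmax R Hs B j =>
  ∃ u : ℂ, IsLowest St η f x₀ s hmax R Hs B j u ∧ tentAt ρ f j u < 1
end Generic




end RhW08.Round1








namespace RhW08.Round1

open Complex
open RhIdea6.G17.W07C7 RhIdea6.G17.W07C7.Rev6 RhIdea6.G18.W07C8.Law421BirthS RhIdea6.G19.W07C11.Seam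
open RhIdea6.G20.W07C12.Frac RhIdea6.G20.W07C12.StColP RhW07.C12.FieldSplit RhIdea6.G21.W07C13.TentMax
open RhW07.C14.TwoSided RhW07.C14.Classes RhW07.C14.Lineage RhW07.C14.Booking
open RhW07.C13.Heredity RhIdea6.G22.W07C15pre.Injection RhW07.E3.Cell
open RhW07.E3.Lit

section TrackedD

/-- one DOWN-FIRST tracked step: `u'` is a next-level `StCol'` state which is EITHER not higher than `u` and nearest in ℂ among the not-higher ones,
OR (when every next-level state is higher) nearest in ℂ among all. -/
def TrkStepD (η : ℝ) (f : ℂ → ℂ) (x₀ s hmax R Hs : ℝ) (B : ℕ) (m : ℕ) (u u' : ℂ) : Prop :=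
  StCol' η f x₀ s hmax R Hs B (m + 1) u' ∧
    ((u'.im ≤ u.im ∧ ∀ w : ℂ, StCol' η f x₀ s hmax R Hs B (m + 1) w → w.im ≤ u.im → ‖u' - u‖ ≤ ‖w - u‖) ∨
     ((∀ w : ℂ, StCol' η f x₀ s hmax R Hs B (m + 1) w → u.im < w.im) ∧
       ∀ w : ℂ, StCol' η f x₀ s hmax R Hs B (m + 1) w → ‖u' - u‖ ≤ ‖w - u‖))

/-- ★ the DOWN-FIRST TRACKED states at level `j`. -/
def StTrkD : StatePred := fun η f x₀ s hmax R Hs B j u =>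
  ∃ c : ℕ → ℂ, StCol' η f x₀ s hmax R Hs B 0 (c 0) ∧ (c 0).re = x₀ ∧ c j = u ∧
    ∀ m : ℕ, m < j → TrkStepD η f x₀ s hmax R Hs B m (c m) (c (m + 1))

/-- the texts of record on the down-first lineage. -/
def PTrkD : StatePred := POr PSealC4 (SuccOf (1 / 4) StTrkD)

/-- W-08 round-2 support (E06: C1 g22 TreeR1 body §R1–§R1i (+§R1h)): see the module docstring and the source README. -/
def EmptyTrkD : LevelClass := EmptyClassG StTrkD (3 / 2)

/-- ★ α_T (down-first): STUB. -/
def AlphaSealTrkD : Prop := IsolatedPairDropLowG (1 / 4) PSealC4 StTrkD (CumReady WindowReady)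
end TrackedD

end RhW08.Round1
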